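import Mathlib
import HarnessLib
import Summits.QuantumFields.YangMills.Theorems.HypercubicLimit.Negative.ReflectedDensity
import Summits.QuantumFields.YangMills.Theorems.FradkinShenkerFlowFiniteSusceptibilityWeakCouplingRPCauchySchwarz
import Summits.QuantumFields.YangMills.Theorems.LangevinControlUVOSLegsFromFemtoAndGapStubAssemblyLatticeDist
import Summits.QuantumFields.YangMills.Theorems.LangevinControlUVOSLegsFromFemtoAndGapStubAssemblyShiftDefect
import Summits.QuantumFields.YangMills.Theorems.LangevinControlUVOSLegsFromFemtoAndGapStubUpgrade
import Summits.QuantumFields.YangMills.Theorems.PencilRigidityHypercubicLimitRpBlockMomentPerm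
import Literature.MathematicalPhysics.AQFT.OSAxiomsSchwinger
import Literature.MathematicalPhysics.QuantumFieldTheory.OSData
import Literature.MathematicalPhysics.QuantumLattice.LatticeScalarField
import Literature.MathematicalPhysics.QuantumLattice.SchwartzNuclearExpansionBounds
import Literature.MathematicalPhysics.QuantumFieldTheory.LatticeGaugeStaticPotentialProofs
import Literature.Probability.LatticeModels.ThermodynamicLimit

/-!
# `HypercubicLimit`, line `conditional-mean-telescoping` (c1 blocks, wave 4): stub `rpBlock_latticeDistPerm`

Support file (`--supports stmt-QuantumFields-8646`) for crux
`Summit.QuantumFields.YangMills.Theses.PencilRigidity.HypercubicLimit`, line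
`conditional-mean-telescoping`: the registered c1 block `rpBlock_latticeDistPerm` — **exact
coordinate-permutation invariance of the curvature's lattice distribution**.

The sibling toolkit's `latticeDist ρ β L a O M n F = ∑_{x ∈ (box L)ⁿ} W(x) F(a x)`
(`latticeDist_apply`, file `Theorems/LangevinControlUVOSLegsFromFemtoAndGapStubAssemblyLatticeDist.lean`)
of the curvature species `O = r.curvature.F` takes the same value on `F` and on the diagonal action
`linActMulti R F`, `(linActMulti R F)(y) = F(R⁻¹ y₁, …, R⁻¹ yₙ)`, of the coordinate permutation
`R = LinearIsometryEquiv.piLpCongrLeft 2 ℝ ℝ π` of `ℝ⁴`.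

Route (tree vocabulary only):
* `R⁻¹ (a • siteToE z) = a • siteToE (sitePermZd π⁻¹ z)` coordinatewise (`ldPerm_symm_smul_siteToE`);
* the box `(box 4 L)ⁿ` is invariant under `x ↦ (sitePermZd π⁻¹ (x k))ₖ`, so the atomic sum is
  re-indexed (`Finset.sum_nbij'`);
* **moment invariance** `W((sitePermZd σ (x k))ₖ) = W(x)` (`ldPerm_torusMoment_perm`): Wilson's torus
  measure is `configPerm σ`-invariant (tree `wilsonMeasure_map_configPerm`), and the curvature at the
  permuted corner of the permuted configuration is the curvature at the corner
  (`ldPerm_curvature_configPerm`): expand it into its six plaquettes (`torusDensity_eq_sum`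
  re-indexed over the subtype of ordered pairs, as in block PLANE), move
  each plaquette with `mPerm_torusPlaquette_configPerm` (orientation `(i, j) ↦ (σ i, σ j)`), and use
  that the sum of a SYMMETRIC function over the ordered pairs `i < j` is invariant under
  `(i, j) ↦ (σ i, σ j)` (`ldPerm_sum_pairs_perm`, via `StaticPotential.sum_lt_eq_half_sum`); the
  plaquette is symmetric in its orientation because `U_{x,ji} = U_{x,ij}⁻¹` (`plaquetteHolonomy_swap`)
  and `Re tr ρ(h⁻¹) = Re tr ρ(h)` (`CompactGroup.re_trace_map_inv`).
-/

noncomputable section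

open scoped SchwartzMap ComplexConjugate
open MeasureTheory Filter Topology
open Literature.MathematicalPhysics.AQFT Literature.MathematicalPhysics.QuantumLattice
open Literature.MathematicalPhysics.QuantumFieldTheory
open Literature.Probability.LatticeModels (box Site)
open Summit.QuantumFields.YangMills.Theorems.HypercubicLimit.Negative (torusPlaquette thetaZ)
open Summit.QuantumFields.YangMills.Theorems.OSLegsFromFemtoAndGap (latticeDist torusMoment)

namespace Summit.QuantumFields.YangMills.Cruxes.HypercubicLimit.ConditionalMeanTelescoping

/-- **Symmetric pair sums, halved.** For a symmetric `g` on `Fin 4 × Fin 4`, the sum over the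
ordered pairs `i < j` is half the full double sum of `g` with its diagonal removed
(`StaticPotential.sum_lt_eq_half_sum`). [folklore] -/
theorem ldPerm_sum_pairs_eq_half (g : Fin 4 → Fin 4 → ℝ) (hg : ∀ i j, g i j = g j i) :
    ∑ q : {q : Fin 4 × Fin 4 // q.1 < q.2}, g q.1.1 q.1.2 =
      (1 / 2) * ∑ i, ∑ j, (if i = j then 0 else g i j) := by
  calc ∑ q : {q : Fin 4 × Fin 4 // q.1 < q.2}, g q.1.1 q.1.2
      = ∑ q : {q : Fin 4 × Fin 4 // q.1 < q.2}, (if q.1.1 = q.1.2 then 0 else g q.1.1 q.1.2) :=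
        Finset.sum_congr rfl fun q _ => (if_neg (ne_of_lt q.2)).symm
    _ = (1 / 2) * ∑ i, ∑ j, (if i = j then 0 else g i j) :=
        StaticPotential.sum_lt_eq_half_sum (fun i j => if i = j then 0 else g i j)
          (fun i j => by
            by_cases h : i = j
            · subst h; rfl
            · rw [if_neg h, if_neg (Ne.symm h), hg])
          (fun i => if_pos rfl)

/-- **Symmetric pair sums are invariant under coordinate permutations.** For a symmetric `g` on
`Fin 4 × Fin 4` and a permutation `σ` of `Fin 4`, summing `g (σ i) (σ j)` over the ordered pairs
`i < j` gives the sum of `g i j` over the ordered pairs: `(i, j) ↦ {σ i, σ j}` permutes the six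
unordered pairs. [folklore] -/
theorem ldPerm_sum_pairs_perm (g : Fin 4 → Fin 4 → ℝ) (hg : ∀ i j, g i j = g j i)
    (σ : Equiv.Perm (Fin 4)) :
    ∑ q : {q : Fin 4 × Fin 4 // q.1 < q.2}, g (σ q.1.1) (σ q.1.2) =
      ∑ q : {q : Fin 4 × Fin 4 // q.1 < q.2}, g q.1.1 q.1.2 := by
  rw [ldPerm_sum_pairs_eq_half (fun i j => g (σ i) (σ j)) (fun i j => hg _ _),
    ldPerm_sum_pairs_eq_half g hg]
  congr 1
  exact Fintype.sum_equiv σ _ _ fun i => Fintype.sum_equiv σ _ _ fun j => by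
    simp only [EmbeddingLike.apply_eq_iff_eq]

/-- **The plaquette observable is symmetric in its orientation**: `p_{ji}(y) = p_{ij}(y)` on the
torus, since `U_{y,ji} = U_{y,ij}⁻¹` (`plaquetteHolonomy_swap`) and `Re tr ρ(h⁻¹) = Re tr ρ(h)` for a
continuous representation of a compact group (`CompactGroup.re_trace_map_inv`). [folklore] -/
theorem ldPerm_torusPlaquette_swap {G : Type} [Group G] [TopologicalSpace G] [IsTopologicalGroup G]
    [CompactSpace G] [MeasurableSpace G] [BorelSpace G] (r : LatticeRep G) (L' : ℕ) (i j : Fin 4)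
    (y : Fin 4 → ℤ) (U : GaugeConfig 4 L' G) :
    torusPlaquette r L' i j y U = torusPlaquette r L' j i y U := by
  unfold Summit.QuantumFields.YangMills.Theorems.HypercubicLimit.Negative.torusPlaquette plaquetteObs
  rw [Theorems.CurvatureBoostCovariance.Negative.plaquetteHolonomyZd_torusLift',
    Theorems.CurvatureBoostCovariance.Negative.plaquetteHolonomyZd_torusLift',
    Literature.MathematicalPhysics.QuantumFieldTheory.plaquetteHolonomy_swap U _ i j,
    Literature.RepresentationTheory.CompactGroups.CompactGroup.re_trace_map_inv r.ρ r.continuous]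

/-- `sitePermZd σ y` is the corner `l ↦ y (σ⁻¹ l)` (tree `sitePermZd_apply`, definitional).
[folklore] -/
theorem ldPerm_sitePermZd_eq (σ : Equiv.Perm (Fin 4)) (y : Fin 4 → ℤ) :
    (sitePermZd σ y : Fin 4 → ℤ) = fun l => y (σ.symm l) := rfl

/-- **The curvature at the permuted corner of the permuted configuration is the curvature at the
corner.** Expand into the six plaquettes (`torusDensity_eq_sum`, re-indexed over the subtype of
ordered pairs as in block PLANE's `planeE_curvature_eq_sum`), move each plaquette
(`mPerm_torusPlaquette_configPerm`) and re-index the symmetric pair sum (`ldPerm_sum_pairs_perm`).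
[folklore] -/
theorem ldPerm_curvature_configPerm {G : Type} [Group G] [TopologicalSpace G] [IsTopologicalGroup G]
    [CompactSpace G] [MeasurableSpace G] [BorelSpace G] (r : LatticeRep G) (L' : ℕ)
    (σ : Equiv.Perm (Fin 4)) (y : Fin 4 → ℤ) (U : GaugeConfig 4 L' G) :
    r.curvature.F (configShift (-(sitePermZd σ y)) (torusLift L' (configPerm σ U))) =
      r.curvature.F (configShift (-y) (torusLift L' U)) := by
  -- the six-plaquette expansion of the curvature at a corner, over the subtype of ordered pairs
  -- (adapted from block PLANE's `planeE_curvature_eq_sum` / `planeE_sum_ite_eq_sum_subtype`)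
  have hexp : ∀ (y' : Fin 4 → ℤ) (U' : GaugeConfig 4 L' G),
      r.curvature.F (configShift (-y') (torusLift L' U')) =
        ∑ q : {q : Fin 4 × Fin 4 // q.1 < q.2}, torusPlaquette r L' q.1.1 q.1.2 y' U' := by
    intro y' U'
    rw [← Finset.sum_subtype (Finset.univ.filter fun q : Fin 4 × Fin 4 => q.1 < q.2) (by simp)
        (fun q : Fin 4 × Fin 4 => torusPlaquette r L' q.1 q.2 y' U'), Finset.sum_filter,
      Fintype.sum_prod_type]
    exact Summit.QuantumFields.YangMills.Theorems.HypercubicLimit.Negative.torusDensity_eq_sum r L' y' U'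
  rw [hexp, hexp,
    ← ldPerm_sum_pairs_perm (fun i j => torusPlaquette r L' i j (sitePermZd σ y) (configPerm σ U))
      (fun i j => ldPerm_torusPlaquette_swap r L' i j _ _) σ]
  refine Finset.sum_congr rfl fun q _ => ?_
  rw [ldPerm_sitePermZd_eq]
  exact mPerm_torusPlaquette_configPerm r L' σ q.1.1 q.1.2 y U

/-- **Moment invariance under coordinate permutations.** The toolkit's centred torus moment of the
curvature species at the permuted corners `(sitePermZd σ (x k))ₖ` equals the moment at `x`: change
variables by the measure-preserving `configPerm σ` (tree `wilsonMeasure_map_configPerm`) and use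
`ldPerm_curvature_configPerm` factor by factor. [folklore] -/
theorem ldPerm_torusMoment_perm {G : Type} [Group G] [TopologicalSpace G] [IsTopologicalGroup G]
    [CompactSpace G] [MeasurableSpace G] [BorelSpace G] (r : LatticeRep G) (β : ℝ) (L : ℕ) (M : ℝ)
    (σ : Equiv.Perm (Fin 4)) {n : ℕ} (x : Fin n → (Fin 4 → ℤ)) :
    torusMoment r.ρ β L r.curvature.F M (fun k => sitePermZd σ (x k)) =
      torusMoment r.ρ β L r.curvature.F M x := by
  haveI : NeZero (2 * L + 1) := ⟨by omega⟩
  unfold Summit.QuantumFields.YangMills.Theorems.OSLegsFromFemtoAndGap.torusMoment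
  have h := integral_map_equiv (μ := (wilsonMeasure r.ρ β : Measure (GaugeConfig 4 (2 * L + 1) G)))
    (configPerm σ) (fun U => ∏ k, (r.curvature.F
      (configShift (-(sitePermZd σ (x k))) (torusLift (2 * L + 1) U)) - M))
  rw [wilsonMeasure_map_configPerm r.ρ r.continuous β σ] at h
  rw [h]
  simp only [ldPerm_curvature_configPerm]

/-- **The inverse coordinate permutation of a scaled lattice site**:
`R⁻¹ (a • z) = a • (sitePermZd π⁻¹ z)` for `R = piLpCongrLeft 2 ℝ ℝ π`, coordinatewise
(`piLpCongrLeft_symm`, `piCongrLeft'_apply`, `siteToE_apply`). [folklore] -/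
theorem ldPerm_symm_smul_siteToE (π : Equiv.Perm (Fin 4)) (a : ℝ) (z : Fin 4 → ℤ) :
    (LinearIsometryEquiv.piLpCongrLeft 2 ℝ ℝ π).symm (a • siteToE z) =
      a • siteToE (sitePermZd π.symm z) := by
  ext j
  simp [LinearIsometryEquiv.piLpCongrLeft_apply, sitePermZd_apply]

/-- **The box power is invariant under coordinate permutations of the corners.** [folklore] -/
theorem ldPerm_perm_mem_piFinset_box {n : ℕ} (L : ℕ) (σ : Equiv.Perm (Fin 4))
    {x : Fin n → (Fin 4 → ℤ)} (hx : x ∈ Fintype.piFinset fun _ : Fin n => box 4 L) :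
    (fun k => sitePermZd σ (x k)) ∈ Fintype.piFinset fun _ : Fin n => box 4 L := by
  simp only [Fintype.mem_piFinset, Literature.Probability.LatticeModels.mem_box,
    sitePermZd_apply] at hx ⊢
  exact fun k i => hx k (σ.symm i)

/-- **Block PERM (exact coordinate-permutation invariance of the curvature's lattice distribution).** The
toolkit's `latticeDist` of `r.curvature.F` (any centring `M`) is invariant under the diagonal action of the
coordinate permutation `π` of `ℝ⁴` on test functions: the box and the set of the six plaquette orientations
are `π`-invariant, `Re tr ρ(U_p⁻¹) = Re tr ρ(U_p)`, and Wilson's torus measure is `configPerm`-invariant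
(`wilsonMeasure_map_configPerm`). [folklore] -/
theorem rpBlock_latticeDistPerm :
    ∀ (G : Type) [Group G] [TopologicalSpace G] [IsTopologicalGroup G] [CompactSpace G]
      [MeasurableSpace G] [BorelSpace G] (r : LatticeRep G) (β : ℝ) (L : ℕ) (a M : ℝ) (n : ℕ)
      (π : Equiv.Perm (Fin 4)) (F : 𝓢((Fin n → EuclideanSpace ℝ (Fin 4)), ℂ)),
      latticeDist r.ρ β L a r.curvature.F M n
          (linActMulti (LinearIsometryEquiv.piLpCongrLeft 2 ℝ ℝ π) F) =
        latticeDist r.ρ β L a r.curvature.F M n F := by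
  intro G _ _ _ _ _ _ r β L a M n π F
  rw [Summit.QuantumFields.YangMills.Theorems.OSLegsFromFemtoAndGap.latticeDist_apply,
    Summit.QuantumFields.YangMills.Theorems.OSLegsFromFemtoAndGap.latticeDist_apply]
  simp only [linActMulti_apply, ldPerm_symm_smul_siteToE]
  refine Finset.sum_nbij' (fun x k => sitePermZd π.symm (x k)) (fun x k => sitePermZd π (x k))
    (fun x hx => ldPerm_perm_mem_piFinset_box L π.symm hx)
    (fun x hx => ldPerm_perm_mem_piFinset_box L π hx) (fun x _ => ?_) (fun x _ => ?_) (fun x _ => ?_)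
  · funext k l
    simp [sitePermZd_apply]
  · funext k l
    simp [sitePermZd_apply]
  · rw [ldPerm_torusMoment_perm r β L M π.symm x]

end Summit.QuantumFields.YangMills.Cruxes.HypercubicLimit.ConditionalMeanTelescoping

end
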